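import Summits.BirchSwinnertonDyer.BirchSwinnertonDyer.Theorems.ByReductionTypeAtTwoFineSelmerConjAAtTwoAdditivePotGoodTwoLayerDoorEvenIndex
import Summits.BirchSwinnertonDyer.BirchSwinnertonDyer.Theorems.ByReductionTypeAtTwoFineSelmerConjAAtTwoAdditivePotGoodClassNumberOne780
import HarnessLib

/-!
# Route `ByReductionTypeAtTwo` (rung K4), crux C1″ `FineSelmerConjAAtTwoAdditivePotGood` (item stmt-BirchSwinnertonDyer-22615):
# TWO-LAYER STAMPS, EVEN-INDEX TYPE `2 = 𝔭²𝔮`, part D — census rows `413952bm1` (`d = -12936`), `445508b1` (`d = 63644`), `467928d1` (`d = 51992`): Fukuda's index `0` by even-index certificates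
# (kernel), hence (A)₂ modulo `hLim2` and TWO displayed bits per row — the parities of `h(F)` and `h(F(√2))` (census: both odd)
# (a `--supports 22615` file; seat `bsd-2adic-k4-w1` GEN 5; sequel of `…TwoLayerStampsEvenIndexC`)

HONEST FRAMING (cell `bsd-2adic`, D-0036/D-0054/D-0152): per-class stamps; conditional on `hLim2` (Lim 2017 Thm. 3.5 at `2`) BY NAME and on TWO
displayed bits per row: `2 ∤ #Cl(𝓞 ℚ(θ))` (census column `cyc3`) and «`e_1 = 0` along the cyclotomic `ℤ₂`-extensions of `ℚ(θ)`» =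
`2 ∤ h(ℚ(θ, √2))` (`…TwoLayerDoor` §2; census column `cyc6`) — both from `addL2x/gen5/conjA2_census_j289938_classes.tsv`, PARI, NOT kernel
(the fields are too large for a short Minkowski certificate: `|d| ≥ 6756`). KERNEL: irreducibility, `ℚ(P) = ℚ(θ)` (explicit change of
generator to an odd-index model of the field), the even-index certificate (four vectors per field, the seat's `gen/cert_search.py`, verified
as ring identities + one companion determinant), Fukuda's index `0` (`totallyRamifiedFrom_zero_of_evenIndexCertificate`, p689647) and Fukuda's
Thm. 1 (1) (`_holds`). Closes nothing at the `∀`-level; nothing booked; BSD is not proved by any of this. THESE ROWS LEAVE `C1″-RES` FOR THE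
DOOR SIDE (the grade of GEN 4's one-bit door rows, with one bit more).

THE FIELDS (odd-index models, so that `ℤ[θ]` is `2`-maximal and the certificate lives in `ℤ[θ]`): `d = -12936`: `X³ + (-1)X² + (-30)X + (78)`; `d = 63644`: `X³ + (-1)X² + (-112)X + (-270)`; `d = 51992`: `X³ + (-1)X² + (-102)X + (-342)`.

References: [Fukuda1994] Thm. 1 (1); [Lim2017FineSelmer] Thm. 3.5, Lemma 3.2; [CoatesSujatha2005] (A); [Marcus1977] Ch. 2;
cell TSV `addL2x/gen5/conjA2_census_j289938_classes.tsv`.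
-/

set_option autoImplicit false
-- sibling precedent (`…TwoLayerDoorEvenIndex.lean`): the directory name repeats the summit name
set_option linter.dupNamespace false

noncomputable section

open scoped Classical IntermediateField NumberField Real nonZeroDivisors

namespace Summit.BirchSwinnertonDyer.BirchSwinnertonDyer.Theorems.AddKatoTwo

open WeierstrassCurve Field Polynomial IsDedekindDomain NumberField Matrix Literature.NumberTheory.EllipticCurves
  Literature.NumberTheory.GaloisRepresentations
  Literature.NumberTheory.IwasawaTheory
  Summit.BirchSwinnertonDyer.BirchSwinnertonDyer.Theorems.AlignedTransportAtTwoTorsionPointField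
  Summit.BirchSwinnertonDyer.BirchSwinnertonDyer.Theses.ByReductionTypeAtTwo

/-! ## §1 Irreducibility of the models -/

/-- `X³ + (-1)X² + (-30)X + (78)` (a model of the cubic field of discriminant `-12936`) is irreducible over `ℚ` (no root mod `5`). -/
theorem irreducible_cubic_d12936n : Irreducible (Cubic.toPoly ⟨1, ((-1 : ℤ) : ℚ), ((-30 : ℤ) : ℚ), ((78 : ℤ) : ℚ)⟩) :=
  haveI : Fact (Nat.Prime 5) := ⟨by norm_num⟩
  irreducible_cubic_of_no_root_zmod 5 (by decide)

/-- `X³ + (-1)X² + (-112)X + (-270)` (a model of the cubic field of discriminant `63644`) is irreducible over `ℚ` (no root mod `11`). -/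
theorem irreducible_cubic_d63644p : Irreducible (Cubic.toPoly ⟨1, ((-1 : ℤ) : ℚ), ((-112 : ℤ) : ℚ), ((-270 : ℤ) : ℚ)⟩) :=
  haveI : Fact (Nat.Prime 11) := ⟨by norm_num⟩
  irreducible_cubic_of_no_root_zmod 11 (by decide)

/-- `X³ + (-1)X² + (-102)X + (-342)` (a model of the cubic field of discriminant `51992`) is irreducible over `ℚ` (no root mod `23`). -/
theorem irreducible_cubic_d51992p : Irreducible (Cubic.toPoly ⟨1, ((-1 : ℤ) : ℚ), ((-102 : ℤ) : ℚ), ((-342 : ℤ) : ℚ)⟩) :=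
  haveI : Fact (Nat.Prime 23) := ⟨by norm_num⟩
  irreducible_cubic_of_no_root_zmod 23 (by decide)

/-! ## §2 The stamps -/

/-- The census curve `413952bm1` is an elliptic curve. -/
theorem isElliptic_413952bm1' : (⟨0, ((-1 : ℤ) : ℚ), 0, ((-134300735 : ℤ) : ℚ), ((-599008857117 : ℤ) : ℚ)⟩ : WeierstrassCurve ℚ).IsElliptic :=
  isElliptic_cubicModel _ _ _ (by simp only [Cubic.discr]; norm_num)

/-- **(A)₂ for `413952bm1` from TWO parity bits** (a `C1″-RES` row of GEN 4's census: `2 = 𝔭²𝔮` in `ℚ(P)`, `d = -12936`). Granted `hLim2`;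
displayed: «`e_1 = 0` along the cyclotomic `ℤ₂`-extensions of `ℚ(θ)`» = `2 ∤ h(ℚ(θ, √2))` (census `cyc6 = [3]`); `2 ∤ #Cl(𝓞 ℚ(θ))` displayed (census `cyc3 = [3]`).
`θ` is any root of `X³ + (-1)X² + (-30)X + (78)`; KERNEL: `ℚ(P) = ℚ(β) = ℚ(θ)` (`β = -3901 + (-1533)θ + (217)θ²` is a root of the
`2`-division cubic), Fukuda's index `0` by the EVEN-INDEX CERTIFICATE `u = [0, -1, 1]`, `v = [-1, 0, -1]`, `m = [58, -3, -9]`, `m' = [-3583, -1308, 765]`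
(coordinates in `1, θ, θ²`; `N(2 − m'³) = -14230880865242125521069838067082198`, `8 ∤`), Fukuda Thm. 1 (1).
[cite: Lim2017FineSelmer, §3 Thm. 3.5 and Lemma 3.2] [cite: Fukuda1994, Thm. 1 (1), p. 264] -/
theorem conjA_two_413952bm1_of_twoBits
    (hLim2 : Lim2017.thm35_at_two_fineSelmerDual_moduleFinite_of_classicalMuVanishes_of_le_divisionField_four)
    {θ : AlgebraicClosure ℚ} (hθ : aeval θ (Cubic.toPoly ⟨1, ((-1 : ℤ) : ℚ), ((-30 : ℤ) : ℚ), ((78 : ℤ) : ℚ)⟩) = 0)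
    (hh : ¬ 2 ∣ Nat.card (ClassGroup (𝓞 (IntermediateField.adjoin ℚ {θ}))))
    (h1 : haveI : FiniteDimensional ℚ (IntermediateField.adjoin ℚ {θ}) :=
        IntermediateField.adjoin.finiteDimensional ((AlgebraicClosure.isAlgebraic ℚ).isAlgebraic θ).isIntegral
      haveI : NumberField (IntermediateField.adjoin ℚ {θ}) := NumberField.mk
      ∀ κL : ZpExtension (IntermediateField.adjoin ℚ {θ}) 2, κL.IsCyclotomic → classNumberPExp κL 1 = 0)
    (κ : ZpExtension ℚ 2) (hκ : κ.IsCyclotomic) :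
    haveI := isElliptic_413952bm1'
    ∃ (γ : absoluteGaloisGroup ℚ) (D : (⟨0, ((-1 : ℤ) : ℚ), 0, ((-134300735 : ℤ) : ℚ), ((-599008857117 : ℤ) : ℚ)⟩ : WeierstrassCurve ℚ).FineSelmerDualData κ γ),
      Module.Finite ℤ_[2] (RestrictScalars ℤ_[2] (IwasawaAlgebra 2) D.X) := by
  haveI := isElliptic_413952bm1'
  have hθ' : θ ^ 3 + (-1 : AlgebraicClosure ℚ) * θ ^ 2 + (-30 : AlgebraicClosure ℚ) * θ + (78 : AlgebraicClosure ℚ) = 0 := by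
    have := hθ
    simp only [Cubic.toPoly, map_one, one_mul, aeval_add, aeval_mul, aeval_C, aeval_X_pow, aeval_X,
      eq_ratCast, Rat.cast_intCast] at this
    push_cast at this
    linear_combination this
  set β : AlgebraicClosure ℚ := algebraMap ℚ (AlgebraicClosure ℚ) (-3901 : ℚ) +
      algebraMap ℚ (AlgebraicClosure ℚ) (-1533 : ℚ) * θ + algebraMap ℚ (AlgebraicClosure ℚ) (217 : ℚ) * θ ^ 2 with hβdef
  have hβ : aeval β (Cubic.toPoly ⟨1, ((-1 : ℤ) : ℚ), ((-134300735 : ℤ) : ℚ), ((-599008857117 : ℤ) : ℚ)⟩) = 0 := by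
    simp only [Cubic.toPoly, map_one, one_mul, aeval_add, aeval_mul, aeval_C, aeval_X_pow, aeval_X, eq_ratCast,
      Rat.cast_intCast]
    rw [hβdef]
    simp only [eq_ratCast]
    push_cast
    linear_combination ((-1724122428 : AlgebraicClosure ℚ) + (1078983675 : AlgebraicClosure ℚ) * θ + (-206343998 : AlgebraicClosure ℚ) * θ ^ 2 + (10218313 : AlgebraicClosure ℚ) * θ ^ 3) * hθ'
  have hadj : IntermediateField.adjoin ℚ {β} = IntermediateField.adjoin ℚ {θ} := by
    apply le_antisymm
    · rw [IntermediateField.adjoin_simple_le_iff, hβdef]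
      have hθmem := IntermediateField.mem_adjoin_simple_self ℚ θ
      exact add_mem (add_mem (algebraMap_mem _ _) (mul_mem (algebraMap_mem _ _) hθmem))
        (mul_mem (algebraMap_mem _ _) (pow_mem hθmem 2))
    · rw [IntermediateField.adjoin_simple_le_iff]
      have hθeq : θ = algebraMap ℚ (AlgebraicClosure ℚ) (925178327/55566 : ℚ) +
          algebraMap ℚ (AlgebraicClosure ℚ) (103678/83349 : ℚ) * β +
          algebraMap ℚ (AlgebraicClosure ℚ) (-31/166698 : ℚ) * β ^ 2 := by
        rw [hβdef]; simp only [eq_ratCast]; push_cast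
        linear_combination (((-391127 : AlgebraicClosure ℚ) / 3402) + ((29791 : AlgebraicClosure ℚ) / 3402) * θ) * hθ'
      rw [hθeq]
      have hβmem := IntermediateField.mem_adjoin_simple_self ℚ β
      exact add_mem (add_mem (algebraMap_mem _ _) (mul_mem (algebraMap_mem _ _) hβmem))
        (mul_mem (algebraMap_mem _ _) (pow_mem hβmem 2))
  obtain ⟨P₀, hP₀, hP₀eq⟩ := exists_geomTorsion_two_eq_some_root ((-1 : ℤ) : ℚ) ((-134300735 : ℤ) : ℚ)
    ((-599008857117 : ℤ) : ℚ) hβ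
  have hF : IntermediateField.fixedField (MulAction.stabilizer (absoluteGaloisGroup ℚ) P₀) =
      IntermediateField.adjoin ℚ {θ} := by
    rw [fixedField_stabilizer_eq_adjoin_root _ _ _ hβ hP₀eq, ← hadj]
    -- the two `Algebra ℚ ℚ̄` instance paths agree
    congr 1
  -- the even-index certificate in `𝓞 ℚ(θ)`
  have hirr := irreducible_cubic_d12936n
  haveI : FiniteDimensional ℚ (IntermediateField.adjoin ℚ {θ}) :=
    IntermediateField.adjoin.finiteDimensional ((AlgebraicClosure.isAlgebraic ℚ).isAlgebraic θ).isIntegral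
  haveI : NumberField (IntermediateField.adjoin ℚ {θ}) := NumberField.mk
  obtain ⟨B, -, hB⟩ := exists_ringOfIntegers_cubic_root (p := -1) (q := -30) (r := 78) hθ
  have h3 := finrank_adjoin_eq_three_of_irreducible hirr hθ
  refine fineSelmerDual_moduleFinite_two_of_evenIndexCertificate_pointField hLim2 _ hP₀ (p := -1) (q := -30) (r := 78) hirr hθ hF
    (((0 : ℤ) : 𝓞 (IntermediateField.adjoin ℚ {θ})) + ((-1 : ℤ) : 𝓞 (IntermediateField.adjoin ℚ {θ})) * B + ((1 : ℤ) : 𝓞 (IntermediateField.adjoin ℚ {θ})) * B ^ 2) (((-1 : ℤ) : 𝓞 (IntermediateField.adjoin ℚ {θ})) + ((0 : ℤ) : 𝓞 (IntermediateField.adjoin ℚ {θ})) * B + ((-1 : ℤ) : 𝓞 (IntermediateField.adjoin ℚ {θ})) * B ^ 2) (((58 : ℤ) : 𝓞 (IntermediateField.adjoin ℚ {θ})) + ((-3 : ℤ) : 𝓞 (IntermediateField.adjoin ℚ {θ})) * B + ((-9 : ℤ) : 𝓞 (IntermediateField.adjoin ℚ {θ})) * B ^ 2) (((-3583 : ℤ)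 : 𝓞 (IntermediateField.adjoin ℚ {θ})) + ((-1308 : ℤ) : 𝓞 (IntermediateField.adjoin ℚ {θ})) * B + ((765 : ℤ) : 𝓞 (IntermediateField.adjoin ℚ {θ})) * B ^ 2) ?_ ?_ ?_
    hh h1 κ hκ
  · push_cast; linear_combination (((-3 : ℤ) : 𝓞 (IntermediateField.adjoin ℚ {θ})) + ((-1 : ℤ) : 𝓞 (IntermediateField.adjoin ℚ {θ})) * B) * hB
  · push_cast; linear_combination (((135 : ℤ) : 𝓞 (IntermediateField.adjoin ℚ {θ})) + ((81 : ℤ) : 𝓞 (IntermediateField.adjoin ℚ {θ})) * B) * hB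
  · have hz : (2 : 𝓞 (IntermediateField.adjoin ℚ {θ})) - (((-3583 : ℤ) : 𝓞 (IntermediateField.adjoin ℚ {θ})) + ((-1308 : ℤ) : 𝓞 (IntermediateField.adjoin ℚ {θ})) * B + ((765 : ℤ) : 𝓞 (IntermediateField.adjoin ℚ {θ})) * B ^ 2) ^ 3 =
        ((-4781468099427 : ℤ) : 𝓞 (IntermediateField.adjoin ℚ {θ})) + (2626100578836 : ℤ) * B + (-369924015447 : ℤ) * B ^ 2 := by
      push_cast; linear_combination (((61890593022 : ℤ) : 𝓞 (IntermediateField.adjoin ℚ {θ})) + ((-9218037330 : ℤ) : 𝓞 (IntermediateField.adjoin ℚ {θ})) * B + ((1848725775 : ℤ) : 𝓞 (IntermediateField.adjoin ℚ {θ})) * B ^ 2 + ((-447697125 : ℤ) : 𝓞 (IntermediateField.adjoin ℚ {θ})) * B ^ 3) * hB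
    rw [hz]
    exact not_eight_dvd_norm_coords _ h3 B hirr hB (-4781468099427) (2626100578836) (-369924015447) (N := -14230880865242125521069838067082198)
      (by simp only [Matrix.one_fin_three, Matrix.det_fin_three, Matrix.add_apply, Matrix.smul_apply, sq, Matrix.mul_apply,
        Fin.sum_univ_three, Matrix.of_apply, Matrix.cons_val', Matrix.cons_val_zero, Matrix.cons_val_one, Matrix.cons_val_two,
        Matrix.head_cons, Matrix.tail_cons, Matrix.empty_val', Matrix.cons_val_fin_one, smul_eq_mul]; norm_num) (by norm_num)

/-- The census curve `445508b1` is an elliptic curve. -/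
theorem isElliptic_445508b1' : (⟨0, ((-1 : ℤ) : ℚ), 0, ((-14574772 : ℤ) : ℚ), ((-21411754440 : ℤ) : ℚ)⟩ : WeierstrassCurve ℚ).IsElliptic :=
  isElliptic_cubicModel _ _ _ (by simp only [Cubic.discr]; norm_num)

/-- **(A)₂ for `445508b1` from TWO parity bits** (a `C1″-RES` row of GEN 4's census: `2 = 𝔭²𝔮` in `ℚ(P)`, `d = 63644`). Granted `hLim2`;
displayed: «`e_1 = 0` along the cyclotomic `ℤ₂`-extensions of `ℚ(θ)`» = `2 ∤ h(ℚ(θ, √2))` (census `cyc6 = []`); `2 ∤ #Cl(𝓞 ℚ(θ))` displayed (census `cyc3 = []`).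
`θ` is any root of `X³ + (-1)X² + (-112)X + (-270)`; KERNEL: `ℚ(P) = ℚ(β) = ℚ(θ)` (`β = 5682 + (280)θ + (-77)θ²` is a root of the
`2`-division cubic), Fukuda's index `0` by the EVEN-INDEX CERTIFICATE `u = [-2, -2, 0]`, `v = [0, -1, -1]`, `m = [-404, -301, -57]`, `m' = [5152613, 2663747, 269054]`
(coordinates in `1, θ, θ²`; `N(2 − m'³) = -31921748707874312141244519307757376674485156950`, `8 ∤`), Fukuda Thm. 1 (1).
[cite: Lim2017FineSelmer, §3 Thm. 3.5 and Lemma 3.2] [cite: Fukuda1994, Thm. 1 (1), p. 264] -/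
theorem conjA_two_445508b1_of_twoBits
    (hLim2 : Lim2017.thm35_at_two_fineSelmerDual_moduleFinite_of_classicalMuVanishes_of_le_divisionField_four)
    {θ : AlgebraicClosure ℚ} (hθ : aeval θ (Cubic.toPoly ⟨1, ((-1 : ℤ) : ℚ), ((-112 : ℤ) : ℚ), ((-270 : ℤ) : ℚ)⟩) = 0)
    (hh : ¬ 2 ∣ Nat.card (ClassGroup (𝓞 (IntermediateField.adjoin ℚ {θ}))))
    (h1 : haveI : FiniteDimensional ℚ (IntermediateField.adjoin ℚ {θ}) :=
        IntermediateField.adjoin.finiteDimensional ((AlgebraicClosure.isAlgebraic ℚ).isAlgebraic θ).isIntegral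
      haveI : NumberField (IntermediateField.adjoin ℚ {θ}) := NumberField.mk
      ∀ κL : ZpExtension (IntermediateField.adjoin ℚ {θ}) 2, κL.IsCyclotomic → classNumberPExp κL 1 = 0)
    (κ : ZpExtension ℚ 2) (hκ : κ.IsCyclotomic) :
    haveI := isElliptic_445508b1'
    ∃ (γ : absoluteGaloisGroup ℚ) (D : (⟨0, ((-1 : ℤ) : ℚ), 0, ((-14574772 : ℤ) : ℚ), ((-21411754440 : ℤ) : ℚ)⟩ : WeierstrassCurve ℚ).FineSelmerDualData κ γ),
      Module.Finite ℤ_[2] (RestrictScalars ℤ_[2] (IwasawaAlgebra 2) D.X) := by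
  haveI := isElliptic_445508b1'
  have hθ' : θ ^ 3 + (-1 : AlgebraicClosure ℚ) * θ ^ 2 + (-112 : AlgebraicClosure ℚ) * θ + (-270 : AlgebraicClosure ℚ) = 0 := by
    have := hθ
    simp only [Cubic.toPoly, map_one, one_mul, aeval_add, aeval_mul, aeval_C, aeval_X_pow, aeval_X,
      eq_ratCast, Rat.cast_intCast] at this
    push_cast at this
    linear_combination this
  set β : AlgebraicClosure ℚ := algebraMap ℚ (AlgebraicClosure ℚ) (5682 : ℚ) +
      algebraMap ℚ (AlgebraicClosure ℚ) (280 : ℚ) * θ + algebraMap ℚ (AlgebraicClosure ℚ) (-77 : ℚ) * θ ^ 2 with hβdef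
  have hβ : aeval β (Cubic.toPoly ⟨1, ((-1 : ℤ) : ℚ), ((-14574772 : ℤ) : ℚ), ((-21411754440 : ℤ) : ℚ)⟩) = 0 := by
    simp only [Cubic.toPoly, map_one, one_mul, aeval_add, aeval_mul, aeval_C, aeval_X_pow, aeval_X, eq_ratCast,
      Rat.cast_intCast]
    rw [hβdef]
    simp only [eq_ratCast]
    push_cast
    linear_combination ((-293282150 : AlgebraicClosure ℚ) + (36341536 : AlgebraicClosure ℚ) * θ + (4523827 : AlgebraicClosure ℚ) * θ ^ 2 + (-456533 : AlgebraicClosure ℚ) * θ ^ 3) * hθ'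
  have hadj : IntermediateField.adjoin ℚ {β} = IntermediateField.adjoin ℚ {θ} := by
    apply le_antisymm
    · rw [IntermediateField.adjoin_simple_le_iff, hβdef]
      have hθmem := IntermediateField.mem_adjoin_simple_self ℚ θ
      exact add_mem (add_mem (algebraMap_mem _ _) (mul_mem (algebraMap_mem _ _) hθmem))
        (mul_mem (algebraMap_mem _ _) (pow_mem hθmem 2))
    · rw [IntermediateField.adjoin_simple_le_iff]
      have hθeq : θ = algebraMap ℚ (AlgebraicClosure ℚ) (-53436774/49 : ℚ) +
          algebraMap ℚ (AlgebraicClosure ℚ) (-24253/98 : ℚ) * β +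
          algebraMap ℚ (AlgebraicClosure ℚ) (11/98 : ℚ) * β ^ 2 := by
        rw [hβdef]; simp only [eq_ratCast]; push_cast
        linear_combination (((8349 : AlgebraicClosure ℚ) / 2) + ((-1331 : AlgebraicClosure ℚ) / 2) * θ) * hθ'
      rw [hθeq]
      have hβmem := IntermediateField.mem_adjoin_simple_self ℚ β
      exact add_mem (add_mem (algebraMap_mem _ _) (mul_mem (algebraMap_mem _ _) hβmem))
        (mul_mem (algebraMap_mem _ _) (pow_mem hβmem 2))
  obtain ⟨P₀, hP₀, hP₀eq⟩ := exists_geomTorsion_two_eq_some_root ((-1 : ℤ) : ℚ) ((-14574772 : ℤ) : ℚ)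
    ((-21411754440 : ℤ) : ℚ) hβ
  have hF : IntermediateField.fixedField (MulAction.stabilizer (absoluteGaloisGroup ℚ) P₀) =
      IntermediateField.adjoin ℚ {θ} := by
    rw [fixedField_stabilizer_eq_adjoin_root _ _ _ hβ hP₀eq, ← hadj]
    -- the two `Algebra ℚ ℚ̄` instance paths agree
    congr 1
  -- the even-index certificate in `𝓞 ℚ(θ)`
  have hirr := irreducible_cubic_d63644p
  haveI : FiniteDimensional ℚ (IntermediateField.adjoin ℚ {θ}) :=
    IntermediateField.adjoin.finiteDimensional ((AlgebraicClosure.isAlgebraic ℚ).isAlgebraic θ).isIntegral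
  haveI : NumberField (IntermediateField.adjoin ℚ {θ}) := NumberField.mk
  obtain ⟨B, -, hB⟩ := exists_ringOfIntegers_cubic_root (p := -1) (q := -112) (r := -270) hθ
  have h3 := finrank_adjoin_eq_three_of_irreducible hirr hθ
  refine fineSelmerDual_moduleFinite_two_of_evenIndexCertificate_pointField hLim2 _ hP₀ (p := -1) (q := -112) (r := -270) hirr hθ hF
    (((-2 : ℤ) : 𝓞 (IntermediateField.adjoin ℚ {θ})) + ((-2 : ℤ) : 𝓞 (IntermediateField.adjoin ℚ {θ})) * B + ((0 : ℤ) : 𝓞 (IntermediateField.adjoin ℚ {θ})) * B ^ 2) (((0 : ℤ) : 𝓞 (IntermediateField.adjoin ℚ {θ})) + ((-1 : ℤ) : 𝓞 (IntermediateField.adjoin ℚ {θ})) * B + ((-1 : ℤ) : 𝓞 (IntermediateField.adjoin ℚ {θ})) * B ^ 2) (((-404 : ℤ) : 𝓞 (IntermediateField.adjoin ℚ {θ})) + ((-301 : ℤ) : 𝓞 (IntermediateField.adjoin ℚ {θ})) * B + ((-57 : ℤ) : 𝓞 (IntermediateField.adjoin ℚ {θ})) * B ^ 2) (((5152613 : ℤ)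 : 𝓞 (IntermediateField.adjoin ℚ {θ})) + ((2663747 : ℤ) : 𝓞 (IntermediateField.adjoin ℚ {θ})) * B + ((269054 : ℤ) : 𝓞 (IntermediateField.adjoin ℚ {θ})) * B ^ 2) ?_ ?_ ?_
    hh h1 κ hκ
  · push_cast; linear_combination (((-6 : ℤ) : 𝓞 (IntermediateField.adjoin ℚ {θ})) + ((-2 : ℤ) : 𝓞 (IntermediateField.adjoin ℚ {θ})) * B) * hB
  · push_cast; linear_combination (((37563 : ℤ) : 𝓞 (IntermediateField.adjoin ℚ {θ})) + ((3249 : ℤ) : 𝓞 (IntermediateField.adjoin ℚ {θ})) * B) * hB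
  · have hz : (2 : 𝓞 (IntermediateField.adjoin ℚ {θ})) - (((5152613 : ℤ) : 𝓞 (IntermediateField.adjoin ℚ {θ})) + ((2663747 : ℤ) : 𝓞 (IntermediateField.adjoin ℚ {θ})) * B + ((269054 : ℤ) : 𝓞 (IntermediateField.adjoin ℚ {θ})) * B ^ 2) ^ 3 =
        ((-33323579179492599784185 : ℤ) : 𝓞 (IntermediateField.adjoin ℚ {θ})) + (-16577448121126689252653 : ℤ) * B + (-1493544940251771126546 : ℤ) * B ^ 2 := by
      push_cast; linear_combination (((-122914001070771213977 : ℤ) : 𝓞 (IntermediateField.adjoin ℚ {θ})) + ((-9625619191682651170 : ℤ) : 𝓞 (IntermediateField.adjoin ℚ {θ})) * B + ((-597963208672360220 : ℤ) : 𝓞 (IntermediateField.adjoin ℚ {θ})) * B ^ 2 + ((-19476833835369464 : ℤ) : 𝓞 (IntermediateField.adjoin ℚ {θ})) * B ^ 3) * hB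
    rw [hz]
    exact not_eight_dvd_norm_coords _ h3 B hirr hB (-33323579179492599784185) (-16577448121126689252653) (-1493544940251771126546) (N := -31921748707874312141244519307757376674485156950)
      (by simp only [Matrix.one_fin_three, Matrix.det_fin_three, Matrix.add_apply, Matrix.smul_apply, sq, Matrix.mul_apply,
        Fin.sum_univ_three, Matrix.of_apply, Matrix.cons_val', Matrix.cons_val_zero, Matrix.cons_val_one, Matrix.cons_val_two,
        Matrix.head_cons, Matrix.tail_cons, Matrix.empty_val', Matrix.cons_val_fin_one, smul_eq_mul]; norm_num) (by norm_num)

/-- The census curve `467928d1` is an elliptic curve. -/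
theorem isElliptic_467928d1' : (⟨0, ((0 : ℤ) : ℚ), 0, ((-434619795 : ℤ) : ℚ), ((-3475423424306 : ℤ) : ℚ)⟩ : WeierstrassCurve ℚ).IsElliptic :=
  isElliptic_cubicModel _ _ _ (by simp only [Cubic.discr]; norm_num)

/-- **(A)₂ for `467928d1` from TWO parity bits** (a `C1″-RES` row of GEN 4's census: `2 = 𝔭²𝔮` in `ℚ(P)`, `d = 51992`). Granted `hLim2`;
displayed: «`e_1 = 0` along the cyclotomic `ℤ₂`-extensions of `ℚ(θ)`» = `2 ∤ h(ℚ(θ, √2))` (census `cyc6 = []`); `2 ∤ #Cl(𝓞 ℚ(θ))` displayed (census `cyc3 = []`).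
`θ` is any root of `X³ + (-1)X² + (-102)X + (-342)`; KERNEL: `ℚ(P) = ℚ(β) = ℚ(θ)` (`β = -10555 + (1120)θ + (149)θ²` is a root of the
`2`-division cubic), Fukuda's index `0` by the EVEN-INDEX CERTIFICATE `u = [0, -1, 1]`, `v = [-1, -1, 0]`, `m = [-86, 59, 25]`, `m' = [615023, 284126, 33253]`
(coordinates in `1, θ, θ²`; `N(2 − m'³) = -2526717416341446413051976875906584671934729051110`, `8 ∤`), Fukuda Thm. 1 (1).
[cite: Lim2017FineSelmer, §3 Thm. 3.5 and Lemma 3.2] [cite: Fukuda1994, Thm. 1 (1), p. 264] -/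
theorem conjA_two_467928d1_of_twoBits
    (hLim2 : Lim2017.thm35_at_two_fineSelmerDual_moduleFinite_of_classicalMuVanishes_of_le_divisionField_four)
    {θ : AlgebraicClosure ℚ} (hθ : aeval θ (Cubic.toPoly ⟨1, ((-1 : ℤ) : ℚ), ((-102 : ℤ) : ℚ), ((-342 : ℤ) : ℚ)⟩) = 0)
    (hh : ¬ 2 ∣ Nat.card (ClassGroup (𝓞 (IntermediateField.adjoin ℚ {θ}))))
    (h1 : haveI : FiniteDimensional ℚ (IntermediateField.adjoin ℚ {θ}) :=
        IntermediateField.adjoin.finiteDimensional ((AlgebraicClosure.isAlgebraic ℚ).isAlgebraic θ).isIntegral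
      haveI : NumberField (IntermediateField.adjoin ℚ {θ}) := NumberField.mk
      ∀ κL : ZpExtension (IntermediateField.adjoin ℚ {θ}) 2, κL.IsCyclotomic → classNumberPExp κL 1 = 0)
    (κ : ZpExtension ℚ 2) (hκ : κ.IsCyclotomic) :
    haveI := isElliptic_467928d1'
    ∃ (γ : absoluteGaloisGroup ℚ) (D : (⟨0, ((0 : ℤ) : ℚ), 0, ((-434619795 : ℤ) : ℚ), ((-3475423424306 : ℤ) : ℚ)⟩ : WeierstrassCurve ℚ).FineSelmerDualData κ γ),
      Module.Finite ℤ_[2] (RestrictScalars ℤ_[2] (IwasawaAlgebra 2) D.X) := by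
  haveI := isElliptic_467928d1'
  have hθ' : θ ^ 3 + (-1 : AlgebraicClosure ℚ) * θ ^ 2 + (-102 : AlgebraicClosure ℚ) * θ + (-342 : AlgebraicClosure ℚ) = 0 := by
    have := hθ
    simp only [Cubic.toPoly, map_one, one_mul, aeval_add, aeval_mul, aeval_C, aeval_X_pow, aeval_X,
      eq_ratCast, Rat.cast_intCast] at this
    push_cast at this
    linear_combination this
  set β : AlgebraicClosure ℚ := algebraMap ℚ (AlgebraicClosure ℚ) (-10555 : ℚ) +
      algebraMap ℚ (AlgebraicClosure ℚ) (1120 : ℚ) * θ + algebraMap ℚ (AlgebraicClosure ℚ) (149 : ℚ) * θ ^ 2 with hβdef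
  have hβ : aeval β (Cubic.toPoly ⟨1, ((0 : ℤ) : ℚ), ((-434619795 : ℤ) : ℚ), ((-3475423424306 : ℤ) : ℚ)⟩) = 0 := by
    simp only [Cubic.toPoly, map_one, one_mul, aeval_add, aeval_mul, aeval_C, aeval_X_pow, aeval_X, eq_ratCast,
      Rat.cast_intCast]
    rw [hβdef]
    simp only [eq_ratCast]
    push_cast
    linear_combination ((186909918 : AlgebraicClosure ℚ) + (273036242 : AlgebraicClosure ℚ) * θ + (77903309 : AlgebraicClosure ℚ) * θ ^ 2 + (3307949 : AlgebraicClosure ℚ) * θ ^ 3) * hθ'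
  have hadj : IntermediateField.adjoin ℚ {β} = IntermediateField.adjoin ℚ {θ} := by
    apply le_antisymm
    · rw [IntermediateField.adjoin_simple_le_iff, hβdef]
      have hθmem := IntermediateField.mem_adjoin_simple_self ℚ θ
      exact add_mem (add_mem (algebraMap_mem _ _) (mul_mem (algebraMap_mem _ _) hθmem))
        (mul_mem (algebraMap_mem _ _) (pow_mem hθmem 2))
    · rw [IntermediateField.adjoin_simple_le_iff]
      have hθeq : θ = algebraMap ℚ (AlgebraicClosure ℚ) (-21219221939/1100683638 : ℚ) +
          algebraMap ℚ (AlgebraicClosure ℚ) (-729473/2201367276 : ℚ) * β +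
          algebraMap ℚ (AlgebraicClosure ℚ) (149/2201367276 : ℚ) * β ^ 2 := by
        rw [hβdef]; simp only [eq_ratCast]; push_cast
        linear_combination (((-53038189 : AlgebraicClosure ℚ) / 2201367276) + ((-3307949 : AlgebraicClosure ℚ) / 2201367276) * θ) * hθ'
      rw [hθeq]
      have hβmem := IntermediateField.mem_adjoin_simple_self ℚ β
      exact add_mem (add_mem (algebraMap_mem _ _) (mul_mem (algebraMap_mem _ _) hβmem))
        (mul_mem (algebraMap_mem _ _) (pow_mem hβmem 2))
  obtain ⟨P₀, hP₀, hP₀eq⟩ := exists_geomTorsion_two_eq_some_root ((0 : ℤ) : ℚ) ((-434619795 : ℤ) : ℚ)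
    ((-3475423424306 : ℤ) : ℚ) hβ
  have hF : IntermediateField.fixedField (MulAction.stabilizer (absoluteGaloisGroup ℚ) P₀) =
      IntermediateField.adjoin ℚ {θ} := by
    rw [fixedField_stabilizer_eq_adjoin_root _ _ _ hβ hP₀eq, ← hadj]
    -- the two `Algebra ℚ ℚ̄` instance paths agree
    congr 1
  -- the even-index certificate in `𝓞 ℚ(θ)`
  have hirr := irreducible_cubic_d51992p
  haveI : FiniteDimensional ℚ (IntermediateField.adjoin ℚ {θ}) :=
    IntermediateField.adjoin.finiteDimensional ((AlgebraicClosure.isAlgebraic ℚ).isAlgebraic θ).isIntegral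
  haveI : NumberField (IntermediateField.adjoin ℚ {θ}) := NumberField.mk
  obtain ⟨B, -, hB⟩ := exists_ringOfIntegers_cubic_root (p := -1) (q := -102) (r := -342) hθ
  have h3 := finrank_adjoin_eq_three_of_irreducible hirr hθ
  refine fineSelmerDual_moduleFinite_two_of_evenIndexCertificate_pointField hLim2 _ hP₀ (p := -1) (q := -102) (r := -342) hirr hθ hF
    (((0 : ℤ) : 𝓞 (IntermediateField.adjoin ℚ {θ})) + ((-1 : ℤ) : 𝓞 (IntermediateField.adjoin ℚ {θ})) * B + ((1 : ℤ) : 𝓞 (IntermediateField.adjoin ℚ {θ})) * B ^ 2) (((-1 : ℤ) : 𝓞 (IntermediateField.adjoin ℚ {θ})) + ((-1 : ℤ) : 𝓞 (IntermediateField.adjoin ℚ {θ})) * B + ((0 : ℤ) : 𝓞 (IntermediateField.adjoin ℚ {θ})) * B ^ 2) (((-86 : ℤ) : 𝓞 (IntermediateField.adjoin ℚ {θ})) + ((59 : ℤ) : 𝓞 (IntermediateField.adjoin ℚ {θ})) * B + ((25 : ℤ) : 𝓞 (IntermediateField.adjoin ℚ {θ})) * B ^ 2) (((615023 : ℤ)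 : 𝓞 (IntermediateField.adjoin ℚ {θ})) + ((284126 : ℤ) : 𝓞 (IntermediateField.adjoin ℚ {θ})) * B + ((33253 : ℤ) : 𝓞 (IntermediateField.adjoin ℚ {θ})) * B ^ 2) ?_ ?_ ?_
    hh h1 κ hκ
  · push_cast; linear_combination (((-1 : ℤ) : 𝓞 (IntermediateField.adjoin ℚ {θ})) + ((1 : ℤ) : 𝓞 (IntermediateField.adjoin ℚ {θ})) * B) * hB
  · push_cast; linear_combination (((3575 : ℤ) : 𝓞 (IntermediateField.adjoin ℚ {θ})) + ((625 : ℤ) : 𝓞 (IntermediateField.adjoin ℚ {θ})) * B) * hB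
  · have hz : (2 : 𝓞 (IntermediateField.adjoin ℚ {θ})) - (((615023 : ℤ) : 𝓞 (IntermediateField.adjoin ℚ {θ})) + ((284126 : ℤ) : 𝓞 (IntermediateField.adjoin ℚ {θ})) * B + ((33253 : ℤ) : 𝓞 (IntermediateField.adjoin ℚ {θ})) * B ^ 2) ^ 3 =
        ((-63532844781710266905 : ℤ) : 𝓞 (IntermediateField.adjoin ℚ {θ})) + (-24271006325696254698 : ℤ) * B + (-2218670512221180819 : ℤ) * B ^ 2 := by
      push_cast; linear_combination (((-185088334234529970 : ℤ) : 𝓞 (IntermediateField.adjoin ℚ {θ})) + ((-14823337574560438 : ℤ) : 𝓞 (IntermediateField.adjoin ℚ {θ})) * B + ((-979297113792679 : ℤ) : 𝓞 (IntermediateField.adjoin ℚ {θ})) * B ^ 2 + ((-36769904085277 : ℤ) : 𝓞 (IntermediateField.adjoin ℚ {θ})) * B ^ 3) * hB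
    rw [hz]
    exact not_eight_dvd_norm_coords _ h3 B hirr hB (-63532844781710266905) (-24271006325696254698) (-2218670512221180819) (N := -2526717416341446413051976875906584671934729051110)
      (by simp only [Matrix.one_fin_three, Matrix.det_fin_three, Matrix.add_apply, Matrix.smul_apply, sq, Matrix.mul_apply,
        Fin.sum_univ_three, Matrix.of_apply, Matrix.cons_val', Matrix.cons_val_zero, Matrix.cons_val_one, Matrix.cons_val_two,
        Matrix.head_cons, Matrix.tail_cons, Matrix.empty_val', Matrix.cons_val_fin_one, smul_eq_mul]; norm_num) (by norm_num)

end Summit.BirchSwinnertonDyer.BirchSwinnertonDyer.Theorems.AddKatoTwo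

end
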